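import Summits.ValiantsHypothesis.ValiantsHypothesis.Theorems.LacunarySymmetroidMatrixDescartesCensusV19CCheck
import Summits.ValiantsHypothesis.ValiantsHypothesis.Theorems.LacunarySymmetroidMatrixDescartesCensusV19CBox20Keys
import Summits.ValiantsHypothesis.ValiantsHypothesis.Theorems.LacunarySymmetroidMatrixDescartesCensusV20CoverX

/-!
# `MatrixDescartes` census — CASE C (`V = 19`), shells `d₅ ∈ {19, 20}`: the kernel COVER check (every sorted one-collision support is a key, the mirror of a key, or a named exception)

HONEST FRAMING.  Object-search cell `pub-symmetroid`; door-A item `DoorA26 = PosRootLawAt 2 6 19` (stmt-ValiantsHypothesis-19979; OPEN, typed, never asserted)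
and its sharper support rows `PosRootLawOn 2 6 18 d`.  DATA ONLY: Boolean facts by `decide +kernel` — the slice plan exhausts the tops `19 ≤ d₅ ≤ 20`
(`V20.planCoversR`), and `V19C.coverSlicesX` enumerates every sorted support `0 = d₀ < ⋯ < d₅`, `d₅ ∈ {19, 20}`, and checks that each one with exactly `20`
distinct pair sums (`V19C.oneColl`) is one of the `846` keys `V19C.box20Keys`, the mirror of one, or one of the `58` named exceptions `V19C.caseC20Open`.  The
meaning is attached in the box assembly `…CensusV19CBox20` by the cover soundness theorem of `…CensusV19CSoundCover`.  Nothing here bears on the `2`-Sidon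
supports, on `ζ_sym(2,6)` over all supports, on `MatrixDescartes` (stmt-ValiantsHypothesis-18050) or on `VP ≠ VNP`.

[folklore] Bookkeeping; elementary.
-/

-- the D-0017 layout repeats a namespace component (single-conjunct summit); the `dupNamespace` linter flags it; name mandated.
set_option linter.dupNamespace false

namespace Summit.ValiantsHypothesis.ValiantsHypothesis.Theorems.LacunarySymmetroidMatrixDescartes.Census.V19C

/-- The slice plan of the shells `d₅ ∈ {19, 20}`. [folklore] -/
def plan20 : List (ℕ × ℕ × ℕ) := [(19, 4, 18), (20, 4, 19)]

/-- The slice plan exhausts the tops `19 ≤ f ≤ 20`. [folklore] -/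
theorem plan20_covers : V20.planCoversR 19 20 plan20 = true := by
  decide +kernel

/-- **Cover check (kernel), top `19`**: every sorted one-collision support with `d₅ = 19` is a key of `box20Keys`, the mirror of a key, or in `caseC20Open`. [folklore] -/
theorem cover20_a : coverSlicesX caseC20Open box20Keys [(19, 4, 18)] = true := by
  decide +kernel

/-- **Cover check (kernel), top `20`**: every sorted one-collision support with `d₅ = 20` is a key of `box20Keys`, the mirror of a key, or in `caseC20Open`. [folklore] -/
theorem cover20_b : coverSlicesX caseC20Open box20Keys [(20, 4, 19)] = true := by
  decide +kernel

end Summit.ValiantsHypothesis.ValiantsHypothesis.Theorems.LacunarySymmetroidMatrixDescartes.Census.V19C
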